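/-
Copyright (c) 2026 the pub-hodgecm-mathlib formalisation cell (harness21).  Prover seat hodgecm-mathlib-F0P3a-p07 (g11): road «S3-tree» (LEAD F0P3a-plan (g11), architect
A-p16 (g29) ruling A-87 (2) «(c″-F1)»: the frame block (F) of «SPAN-0-ram» DISCHARGED from good reduction), brick «SPAN-0-ram»; 2026-09-01.
-/
import Literature.NumberTheory.Rogawski1990.UnitaryVertexStabilizerSpanSelfDualRamifiedCM   -- ★ p846298 (this seat) (c′): `span_isSelfDual_of_neg`, `span_isSelfDual_std_of_neg` (blocks (R), (F) as hypotheses), `isVertexLattice_smul_iff`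
import Literature.NumberTheory.Automorphic.UnitaryLatticeTreeUnimodularFrame                -- ★ p846325 (this seat) (F1a): `exists_glInt_eq_smul_formCongr_antidiagonal_of_isotropic`
import Literature.NumberTheory.Automorphic.UnitaryLatticeTreeResidualIsotropy               -- ★ p846330 (this seat) (F1b): `exists_primitive_v_pairing_self_lt_one` (Chevalley–Warning)
import Literature.RingTheory.DiscreteValuationRing.AdicCompletionResidueField               -- ★ `finite_residueField_adicCompletion` (`Finite 𝓀[K_v]` from `Finite (A ⧸ v)`)
import Mathlib.LinearAlgebra.FreeModule.IdealQuotient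
import HarnessLib

/-!
# «SPAN-0-ram» WITH THE FRAME DISCHARGED: at a tamely ramified non-split place of GOOD REDUCTION the pieces live on self-dual vertex stabilisers — only the ramified block (R) remains
# (Bruhat–Tits 1972 §10; Rogawski 1990 §4.9; Jacobowitz 1962 §8; Chevalley–Warning)

Topic `NumberTheory/Rogawski1990`; namespace `Literature.NumberTheory.Rogawski1990`.  THEOREMS ONLY (no definition, no instance, no notation, no named fact, no `sorry`); kernel
lane.  Cell `pub/hodgecm-mathlib` (D-0151), crux H413 = `stmt-HodgeConjecture-24833`; road «S3-tree», architect A-87 (2): the frame block (F) of ★ `span_isSelfDual_of_neg` ∕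
★ `span_isSelfDual_std_of_neg` (★ p846298) is PRODUCED from the good-reduction pair `(hH′w, hH′i)` of ★ `span_isSelfDual` by ★ (F1a) `exists_glInt_eq_smul_formCongr_antidiagonal_of_isotropic`
(`H′_w = (−det H′_w)·(σ_w A)ᵀJ₀A`, `A ∈ GL₃(𝒪_w)`) fed by ★ (F1b) `exists_primitive_v_pairing_self_lt_one` (residual isotropy: Chevalley–Warning over the FINITE residue field
`𝓀[L_w]`, finite because `𝓞 L ∕ w` is — Mathlib `Ideal.finiteQuotientOfFreeOfNeBot` + ★ `finite_residueField_adicCompletion`).  So at a tamely ramified `v` the END carries exactly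
the RAMIFIED BLOCK (R): a uniformiser `ϖ` with `σ_w ϖ = −ϖ`, `|σ_w x − x|_w < 1` on `𝒪_w`, `|2|_w = 1`, and (norm) for `σ_w`-fixed `1`-units — whose producer
(«ramifiedLocalConjDatum_adicCompletion») is booked.
HONEST LABEL: HC_CM is proved only modulo the 2 remaining named inputs (hLiu418 24832, h413 24833) until rung 0 closes; nothing printed is asserted here; S3 (`stub_N6nsS3id`)
stays a print row until the road's END lands; block (R) is a hypothesis of every theorem below.

* §1 **`exists_glInt_placeForm_eq_smul_formCongr_antidiagonal_of_neg`** (the frame (F) at a ramified `w` of good reduction, scalar `−det H′_w`).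
* §2 **`span_isSelfDual_of_neg_of_isUnit`**, **`span_isSelfDual_std_of_neg_of_isUnit`** (★ (c′) with (F) discharged: hypotheses = ★ `span_isSelfDual`'s with `hv` ↦ block (R)).

## References
* [BruhatTits1972] F. Bruhat, J. Tits, *Groupes réductifs sur un corps local I*, Publ. Math. IHÉS 41 (1972), §10.
* [Rogawski1990] J. D. Rogawski, *Automorphic Representations of Unitary Groups in Three Variables*, Ann. of Math. Stud. 123 (1990), §4.9 Lemma 4.9.3 p. 56.
* [Jacobowitz1962] R. Jacobowitz, *Hermitian forms over local fields*, Amer. J. Math. 84 (1962), §8.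
* [Serre1973CourseArithmetic] J.-P. Serre, *A Course in Arithmetic* (1973), Ch. I §2 (Chevalley–Warning).
-/

set_option autoImplicit false

noncomputable section

open scoped Valued WithZero Matrix MatrixGroups
open Topology Set NumberField IsDedekindDomain Matrix

namespace Literature.NumberTheory.Rogawski1990

open Literature.NumberTheory.Automorphic Literature.NumberTheory.Automorphic.UnitaryGroup Literature.NumberTheory.GaloisRepresentations
open Literature.NumberTheory.Automorphic.UnitaryLatticeTree Literature.NumberTheory.Automorphic.HermitianLattice

variable (L : Type) [Field L] [NumberField L] [IsCMField L] (H' : Matrix (Fin 3) (Fin 3) L) (v : HeightOneSpectrum (𝓞 ↥(maximalRealSubfield L)))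
  (w : PlacesOver L v) (hw : IsCMField.complexConj L • w.1 = w.1)

/-! ## §1 The frame at a ramified place of good reduction -/

/-- **THE GOOD-REDUCTION FRAME AT A TAMELY RAMIFIED PLACE**: for `H′` `c`-hermitian with good reduction at `w` (`H′_w ∈ GL₃(𝒪_w)`) and the ramified block (R) (`σ_w` trivial on the
residue field, `|2|_w = 1`, (norm)), there is `A ∈ GL₃(𝒪_w)` with `H′_w = (−det H′_w)·(σ_w A)ᵀ J₀ A`, `|det H′_w|_w = 1` — ★ (F1b) residual isotropy (finite residue field) + ★ (F1a).
[cite: Jacobowitz1962, §8] [cite: Serre1973CourseArithmetic, Ch. I §2] [cite: BruhatTits1972, §10] -/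
theorem exists_glInt_placeForm_eq_smul_formCongr_antidiagonal_of_neg (hH' : (H'.map (cmConjRingHom L))ᵀ = H')
    (hH'w : IsUnit (placeForm H' w.1)) (hH'i : hH'w.unit ∈ glInt 3 (w.1.adicCompletion L))
    (hres : ∀ x : w.1.adicCompletion L, Valued.v x ≤ 1 → Valued.v (galAdicCompletionMap (L := L) (IsCMField.complexConj L) hw x - x) < 1) (h2 : Valued.v (2 : w.1.adicCompletion L) = 1)
    (hnorm : ∀ u : w.1.adicCompletion L, galAdicCompletionMap (L := L) (IsCMField.complexConj L) hw u = u → Valued.v (u - 1) < 1 →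
      ∃ z : w.1.adicCompletion L, z * galAdicCompletionMap (L := L) (IsCMField.complexConj L) hw z = u ∧ Valued.v (z - 1) ≤ Valued.v (u - 1)) :
    ∃ A : GL (Fin 3) (w.1.adicCompletion L), A ∈ glInt 3 (w.1.adicCompletion L) ∧ Valued.v (-(placeForm H' w.1).det) = 1 ∧
      placeForm H' w.1 = (-(placeForm H' w.1).det) • formCongr (galAdicCompletionMap (L := L) (IsCMField.complexConj L) hw) A ((StdForm.antidiagonal 3).over (w.1.adicCompletion L)) := by
  have hσσ : ∀ x, galAdicCompletionMap (L := L) (IsCMField.complexConj L) hw (galAdicCompletionMap (L := L) (IsCMField.complexConj L) hw x) = x :=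
    galAdicCompletionMap_galAdicCompletionMap_of_smul_eq (IsCMField.complexConj L) w (IsCMField.complexConj_ne_one L) hw
  have hvσ : ∀ x, Valued.v (galAdicCompletionMap (L := L) (IsCMField.complexConj L) hw x) = Valued.v x := fun x => valued_galAdicCompletionMap (L := L) (IsCMField.complexConj L) hw x
  have h20 : (2 : w.1.adicCompletion L) ≠ 0 := fun h => by rw [h, map_zero] at h2; exact zero_ne_one h2
  have htrace : ∃ t : w.1.adicCompletion L, Valued.v t ≤ 1 ∧ t + galAdicCompletionMap (L := L) (IsCMField.complexConj L) hw t = 1 :=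
    ⟨1 / 2, by rw [map_div₀, map_one, h2, div_one], by rw [map_div₀, map_one, map_ofNat, ← add_div, one_add_one_eq_two, div_self h20]⟩
  have hHh : ((placeForm H' w.1).map (galAdicCompletionMap (L := L) (IsCMField.complexConj L) hw))ᵀ = placeForm H' w.1 := placeForm_hermitian_of_smul_eq (IsCMField.complexConj L) w H' hH' hw
  -- good reduction: `H′_w` integral with unit determinant
  have hgl := (mem_glInt_iff _).1 hH'i
  rw [forall_mem_integer_iff_isIntMatrix, forall_mem_integer_iff_isIntMatrix] at hgl
  have hunit : (hH'w.unit : Matrix (Fin 3) (Fin 3) (w.1.adicCompletion L)) = placeForm H' w.1 := hH'w.unit_spec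
  have hHint : IsIntMatrix (placeForm H' w.1) := by rw [← hunit]; exact hgl.1
  have hdet : Valued.v (placeForm H' w.1).det = 1 := by rw [← hunit]; exact v_det_eq_one_of_isIntMatrix_inv hgl.1 hgl.2
  -- the residue field of `L_w` is finite
  haveI : Finite (𝓞 L ⧸ w.1.asIdeal) := Ideal.finiteQuotientOfFreeOfNeBot _ w.1.ne_bot
  haveI : Finite 𝓀[w.1.adicCompletion L] := inferInstance
  -- (F1b) residual isotropy, then (F1a) the frame
  obtain ⟨x, hx, ⟨i, hxi⟩, hxx⟩ := exists_primitive_v_pairing_self_lt_one (σ := galAdicCompletionMap (L := L) (IsCMField.complexConj L) hw) hres hHint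
  obtain ⟨A, hA, hA', hframe⟩ := exists_glInt_eq_smul_formCongr_antidiagonal_of_isotropic hσσ hvσ htrace hnorm hHh hHint hdet hx hxi hxx
  refine ⟨A, ?_, by rw [Valuation.map_neg, hdet], hframe⟩
  rw [mem_glInt_iff, forall_mem_integer_iff_isIntMatrix, forall_mem_integer_iff_isIntMatrix]
  exact ⟨hA, hA'⟩

/-! ## §2 «SPAN-0-ram» with the frame discharged -/

section Span

variable [iM' : ∀ γ : (cmDatum L 3 H').Local v, MeasurableSpace ((cmDatum L 3 H').Local v ⧸ Subgroup.centralizer ({γ} : Set ((cmDatum L 3 H').Local v)))]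
  [iB' : ∀ γ : (cmDatum L 3 H').Local v, BorelSpace ((cmDatum L 3 H').Local v ⧸ Subgroup.centralizer ({γ} : Set ((cmDatum L 3 H').Local v)))]

/-- **«SPAN-0-ram» AT A PLACE OF GOOD REDUCTION** (A-87 (2)): at a non-split place `v` TAMELY RAMIFIED in `L` with `H′_w ∈ GL₃(𝒪_w)` — block (R) as hypothesis, (F) DISCHARGED (§1) — every `φ ∈ C_c^∞(U(H′)(L⁺_v))` has finitely many pieces `g k`,
each smooth, supported in a COMPACT OPEN stabiliser `K k` of a SELF-DUAL vertex lattice `latt g_k` and `Ad(K k)`-invariant, with `Σᶠ_c Δ(γH, out c)·Φ(c, φ) = Σ_k Σᶠ_c Δ·Φ(c, g k)`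
for all `G`-regular `γH` near `1`** — ★ `span_of_cover` at `P := IsSelfDualLattice σ_w ϖ H′_w (latt ·)` over the §1 cover.  This is the END-contract stub «SPAN» with the
self-dual `IsVertexStab` text of A-66 (1). [cite: Rogawski1990, §4.9 Lemma 4.9.3 p. 56] [cite: LanglandsShelstad1990Descent, §2.1] [cite: BruhatTits1972, §10] -/
theorem span_isSelfDual_of_neg_of_isUnit (hH' : (H'.map (cmConjRingHom L))ᵀ = H') (hdet' : H'.det ≠ 0)
    (hH'w : IsUnit (placeForm H' w.1)) (hH'i : hH'w.unit ∈ glInt 3 (w.1.adicCompletion L))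
    {ϖ : w.1.adicCompletion L} (hϖ : Valued.v ϖ = WithZero.exp (-1 : ℤ)) (hσϖ : galAdicCompletionMap (L := L) (IsCMField.complexConj L) hw ϖ = -ϖ)
    (hres : ∀ x : w.1.adicCompletion L, Valued.v x ≤ 1 → Valued.v (galAdicCompletionMap (L := L) (IsCMField.complexConj L) hw x - x) < 1) (h2 : Valued.v (2 : w.1.adicCompletion L) = 1)
    (hnorm : ∀ u : w.1.adicCompletion L, galAdicCompletionMap (L := L) (IsCMField.complexConj L) hw u = u → Valued.v (u - 1) < 1 →
      ∃ z : w.1.adicCompletion L, z * galAdicCompletionMap (L := L) (IsCMField.complexConj L) hw z = u ∧ Valued.v (z - 1) ≤ Valued.v (u - 1))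
    (T : LocalTransferFactor L H' v) {mG : OrbitalMeasureFamily ((cmDatum L 3 H').Local v)}
    (hmG : mG.IsAdmissibleOn fun γ' => IsRegularElt (γ'.val : GL (Fin 3) (LocalRing L v)))
    (φ : (cmDatum L 3 H').Local v → ℂ) (hφ : IsLocSmooth φ) :
    ∃ (n : ℕ) (K : Fin n → Subgroup ((cmDatum L 3 H').Local v)) (g : Fin n → (cmDatum L 3 H').Local v → ℂ),
      (∀ k, ∃ gk : GL (Fin 3) (w.1.adicCompletion L),
        IsSelfDualLattice (galAdicCompletionMap (L := L) (IsCMField.complexConj L) hw) ϖ (placeForm H' w.1) (latt (gk : Matrix (Fin 3) (Fin 3) (w.1.adicCompletion L))) ∧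
        IsCompact (K k : Set ((cmDatum L 3 H').Local v)) ∧ IsOpen (K k : Set ((cmDatum L 3 H').Local v)) ∧
        ∀ u : (cmDatum L 3 H').Local v, u ∈ K k ↔
          mapGL ((localNonsplitEquiv (IsCMField.complexConj L) H' (IsCMField.complexConj_ne_one L) w hw u :
              ↥(unitaryGroupOfForm (galAdicCompletionMap (L := L) (IsCMField.complexConj L) hw) (placeForm H' w.1))) :
            GL (Fin 3) (w.1.adicCompletion L)) (latt (gk : Matrix (Fin 3) (Fin 3) (w.1.adicCompletion L))) = latt (gk : Matrix (Fin 3) (Fin 3) (w.1.adicCompletion L))) ∧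
      (∀ k, IsLocSmooth (g k)) ∧ (∀ k, tsupport (g k) ⊆ (K k : Set ((cmDatum L 3 H').Local v))) ∧
      (∀ k, ∀ u ∈ K k, ∀ x, g k (u * x * u⁻¹) = g k x) ∧
      ∃ V ∈ 𝓝 (1 : (cmDatum L 2 (Matrix.of fun i j : Fin 2 => if i.val + j.val + 1 = 2 then (1 : L) else 0)).Local v ×
          (cmDatum L 1 (Matrix.of fun i j : Fin 1 => if i.val + j.val + 1 = 1 then (1 : L) else 0)).Local v),
        ∀ γH ∈ V, IsLocalGRegular L v γH →
          (∑ᶠ c : ConjClasses ((cmDatum L 3 H').Local v), T.Δ γH (Quotient.out c) * classOrbitalIntegral mG φ c) =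
            ∑ k, ∑ᶠ c : ConjClasses ((cmDatum L 3 H').Local v), T.Δ γH (Quotient.out c) * classOrbitalIntegral mG (g k) c := by
  obtain ⟨A, -, hc, hA⟩ := exists_glInt_placeForm_eq_smul_formCongr_antidiagonal_of_neg L H' v w hw hH' hH'w hH'i hres h2 hnorm
  exact span_isSelfDual_of_neg L H' v w hw hH' hdet' hϖ hσϖ hres h2 hnorm A hc hA T hmG φ hφ

/-- **«SPAN-0-ram» RE-CENTRED AT `K_std`, GOOD REDUCTION** (A-87 (2)): at a non-split place `v` TAMELY RAMIFIED in `L` with `H′_w ∈ GL₃(𝒪_w)` — block (R) as hypothesis, (F) DISCHARGED — every `φ ∈ C_c^∞(U(H′)(L⁺_v))` has finitely many pieces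
`g k`, each smooth, supported in `K_std = cmLocalIntegralLevel L 3 H′ v` and `Ad(K_std)`-invariant, with `Σᶠ_c Δ(γH, out c)·Φ(c, φ) = Σ_k Σᶠ_c Δ·Φ(c, g k)` for all `G`-regular `γH`
near `1` (★ `span_isSelfDual`, re-centred by §1's `x_k` with `K_k = x_k K_std x_k⁻¹`; orbital integrals by ★ `classOrbitalIntegral_comp_conj` on the regular = `Δ ≠ 0` classes).
This is the END-contract stub «SPAN» WITHOUT `IsVertexStab`. [cite: Rogawski1990, §4.9 Lemma 4.9.3 p. 56] [cite: LanglandsShelstad1990Descent, §2.1] [cite: BruhatTits1972, §10] -/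
theorem span_isSelfDual_std_of_neg_of_isUnit (hH' : (H'.map (cmConjRingHom L))ᵀ = H') (hdet' : H'.det ≠ 0)
    (hH'w : IsUnit (placeForm H' w.1)) (hH'i : hH'w.unit ∈ glInt 3 (w.1.adicCompletion L))
    {ϖ : w.1.adicCompletion L} (hϖ : Valued.v ϖ = WithZero.exp (-1 : ℤ)) (hσϖ : galAdicCompletionMap (L := L) (IsCMField.complexConj L) hw ϖ = -ϖ)
    (hres : ∀ x : w.1.adicCompletion L, Valued.v x ≤ 1 → Valued.v (galAdicCompletionMap (L := L) (IsCMField.complexConj L) hw x - x) < 1) (h2 : Valued.v (2 : w.1.adicCompletion L) = 1)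
    (hnorm : ∀ u : w.1.adicCompletion L, galAdicCompletionMap (L := L) (IsCMField.complexConj L) hw u = u → Valued.v (u - 1) < 1 →
      ∃ z : w.1.adicCompletion L, z * galAdicCompletionMap (L := L) (IsCMField.complexConj L) hw z = u ∧ Valued.v (z - 1) ≤ Valued.v (u - 1))
    (T : LocalTransferFactor L H' v) {mG : OrbitalMeasureFamily ((cmDatum L 3 H').Local v)}
    (hmG : mG.IsAdmissibleOn fun γ' => IsRegularElt (γ'.val : GL (Fin 3) (LocalRing L v)))
    (φ : (cmDatum L 3 H').Local v → ℂ) (hφ : IsLocSmooth φ) :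
    ∃ (n : ℕ) (g : Fin n → (cmDatum L 3 H').Local v → ℂ),
      (∀ k, IsLocSmooth (g k)) ∧ (∀ k, tsupport (g k) ⊆ (cmLocalIntegralLevel L 3 H' v : Set ((cmDatum L 3 H').Local v))) ∧
      (∀ k, ∀ u ∈ cmLocalIntegralLevel L 3 H' v, ∀ x, g k (u * x * u⁻¹) = g k x) ∧
      ∃ V ∈ 𝓝 (1 : (cmDatum L 2 (Matrix.of fun i j : Fin 2 => if i.val + j.val + 1 = 2 then (1 : L) else 0)).Local v ×
          (cmDatum L 1 (Matrix.of fun i j : Fin 1 => if i.val + j.val + 1 = 1 then (1 : L) else 0)).Local v),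
        ∀ γH ∈ V, IsLocalGRegular L v γH →
          (∑ᶠ c : ConjClasses ((cmDatum L 3 H').Local v), T.Δ γH (Quotient.out c) * classOrbitalIntegral mG φ c) =
            ∑ k, ∑ᶠ c : ConjClasses ((cmDatum L 3 H').Local v), T.Δ γH (Quotient.out c) * classOrbitalIntegral mG (g k) c := by
  obtain ⟨A, hAint, hc, hA⟩ := exists_glInt_placeForm_eq_smul_formCongr_antidiagonal_of_neg L H' v w hw hH' hH'w hH'i hres h2 hnorm
  exact span_isSelfDual_std_of_neg L H' v w hw hH' hdet' hϖ hσϖ hres h2 hnorm A hAint hc hA T hmG φ hφ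

end Span

end Literature.NumberTheory.Rogawski1990

end
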